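import Summits.AtomisticToContinuum.Crystallization.Theorems.FreeSplittingCertificatesStrictSplittingRuleFarPencilHcp

/-!
# `StrictSplittingRule` (stmt-AtomisticToContinuum-12560): the TETRAHEDRON receipts form of the hcp honeycomb (first element brick of the transfer lemma)

Route `FreeSplittingCertificates`, crux r3 `StrictSplittingRule` (H12⋆ = `stub_coreJointCoercive`), unit b2b-freesplit-B gen 12.
VALUE = element algebra for the lattice→continuum transfer of the far lemma (HOME FAR-LEMMA-SPEC §7 (e),(k), §10 (e)) — NOT a proof of H12⋆,
NOT summit progress.

On a tetrahedron of the hcp tet–oct honeycomb at the reference site (vertices `0`, `y_(0,1,0)`, `y_(0,0,1)`, `y_(1,0,0)`; its six edges are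
the shell vectors with labels `hcpTetIdx ⊆ hcpStarIdx`) a piecewise-affine interpolant `ṽ` with gradient `G` has edge stretches
`dl_e = ⟪y_e, G y_e⟫`, so the receipts the far family pays on the tetrahedron's edges control the quartic form
`fpTet a h G = Σ_{e} ⟪y_e, G y_e⟫²`:
* `hcpTet_strain_form`: closed form for all `a, h` — exactly half the even part of the shell form (`hcpShell_strain_form`) plus the odd terms
  `(√3/3)a³h[(e₀₀ − e₁₁)e₁₂ + 2e₀₁e₀₂]` (the tetrahedron is not centrosymmetric; they cancel against the mirror tetrahedron in the shell);
* `hcpTet_strain_form_ge`: `fpTet ≥ (1/4)·min(a⁴, a²h², h⁴)·|sym G|²_F` for ALL `a, h` (blockwise `2 × 2` determinants);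
* `fpRec_le_tet`: `min(a⁴, a²h², h⁴)·fpRec G ≤ 16·fpTet a h G` — crude (the sharp constant at the ideal ratio is `16/5`, E-irrep of the tetrahedral
  group) but ample: the far ledger's receipts exceed the pencil's need by the factor `c₆a⁴(333/400)/(17/200) ≈ 32` (CERT §19 (5)), so an `O(1)` loss
  in the element algebra is irrelevant;
* `fpTet_le_fpShell`: the tetrahedron form is dominated by the shell form (subset of nonnegative terms).
HONEST FRAMING: finite-dimensional algebra; the interpolant, the octahedra, the weight variation and the assembly are not here.
-/

noncomputable section

namespace Summit.AtomisticToContinuum.Crystallization.Theorems.StrictSplittingRuleBirth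

open scoped BigOperators
open Literature.MathematicalPhysics.StatisticalMechanics
open Summit.AtomisticToContinuum.Crystallization.Theorems.PalmUnimodularRigidity.LayeredLawsSelectHcp

/-- The six edge labels of the reference tetrahedron `{0, y_(0,1,0), y_(0,0,1), y_(1,0,0)}` of the hcp tet–oct honeycomb:
three in-layer edges `(0,1,0), (0,0,1), (0,1,−1)` and three edges to the apex `(1,0,0), (1,−1,0), (1,0,−1)`. [folklore] -/
def hcpTetIdx : Finset (ℤ × ℤ × ℤ) :=
  {(0, 1, 0), (0, 0, 1), (1, 0, 0), (0, 1, -1), (1, -1, 0), (1, 0, -1)}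

/-- The tetrahedron's edge labels are shell labels. -/
theorem hcpTetIdx_subset_star : hcpTetIdx ⊆ hcpStarIdx := by decide

/-- **The tetrahedron receipts form** `Σ_{e ∈ hcpTetIdx} ⟪y_e, G y_e⟫²` (only `sym G` enters; same integrand as `fpShell`). -/
def fpTet (a h : ℝ) (G : Fin 3 → Fin 3 → ℝ) : ℝ :=
  ∑ s ∈ hcpTetIdx,
    (G 0 0 * hcpSite a h s 0 ^ 2 + G 1 1 * hcpSite a h s 1 ^ 2 + G 2 2 * hcpSite a h s 2 ^ 2 +
        2 * ((G 0 1 + G 1 0) / 2) * (hcpSite a h s 0 * hcpSite a h s 1) +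
        2 * ((G 0 2 + G 2 0) / 2) * (hcpSite a h s 0 * hcpSite a h s 2) +
      2 * ((G 1 2 + G 2 1) / 2) * (hcpSite a h s 1 * hcpSite a h s 2)) ^ 2

/-- Six-term expansion of a sum over the tetrahedron's edge labels. -/
theorem hcpTet_sum_expand {M : Type*} [AddCommMonoid M] (f : ℤ × ℤ × ℤ → M) :
    ∑ s ∈ hcpTetIdx, f s = f (0, 1, 0) + (f (0, 0, 1) + (f (1, 0, 0) + (f (0, 1, -1) + (f (1, -1, 0) + f (1, 0, -1))))) := by
  rw [hcpTetIdx]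
  repeat rw [Finset.sum_insert (by decide)]
  rw [Finset.sum_singleton]

/-- **The tetrahedron strain form in closed form** (all `a, h`; `E` symmetric with entries `eᵢⱼ`):
`Σ_e ⟪y_e, E y_e⟫² = (5/4)a⁴(e₀₀² + e₁₁²) + (5/6)a⁴e₀₀e₁₁ + (5/3)a⁴e₀₁² + a²h²(e₀₀ + e₁₁)e₂₂ + 2a²h²(e₀₂² + e₁₂²) + 3h⁴e₂₂²`
`+ (√3/3)a³h((e₀₀ − e₁₁)e₁₂ + 2e₀₁e₀₂)`. [folklore] -/
theorem hcpTet_strain_form (a h e₀₀ e₁₁ e₂₂ e₀₁ e₀₂ e₁₂ : ℝ) :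
    ∑ s ∈ hcpTetIdx,
        (e₀₀ * hcpSite a h s 0 ^ 2 + e₁₁ * hcpSite a h s 1 ^ 2 + e₂₂ * hcpSite a h s 2 ^ 2 +
            2 * e₀₁ * (hcpSite a h s 0 * hcpSite a h s 1) + 2 * e₀₂ * (hcpSite a h s 0 * hcpSite a h s 2) +
          2 * e₁₂ * (hcpSite a h s 1 * hcpSite a h s 2)) ^ 2 =
      5 / 4 * a ^ 4 * (e₀₀ ^ 2 + e₁₁ ^ 2) + 5 / 6 * a ^ 4 * (e₀₀ * e₁₁) + 5 / 3 * a ^ 4 * e₀₁ ^ 2 +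
            a ^ 2 * h ^ 2 * ((e₀₀ + e₁₁) * e₂₂) + 2 * a ^ 2 * h ^ 2 * (e₀₂ ^ 2 + e₁₂ ^ 2) + 3 * h ^ 4 * e₂₂ ^ 2 +
        √3 / 3 * a ^ 3 * h * ((e₀₀ - e₁₁) * e₁₂ + 2 * (e₀₁ * e₀₂)) := by
  obtain ⟨l0, l1, -⟩ := hcpShell_labels
  have h3 : (√3 : ℝ) ^ 2 = 3 := Real.sq_sqrt (by norm_num)
  have h27 : (√3 : ℝ) ^ 3 = 3 * √3 := by rw [pow_succ, h3]
  have h9 : (√3 : ℝ) ^ 4 = 9 := by rw [show (4 : ℕ) = 2 * 2 by norm_num, pow_mul, h3]; norm_num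
  rw [hcpTet_sum_expand]
  simp only [hcpSite_apply_zero, hcpSite_apply_one, hcpSite_apply_two, l0, l1]
  push_cast
  ring_nf
  rw [h3, h27, h9]
  ring

/-- **Lower bound of the tetrahedron strain form for all `a, h`**: `Σ_e ⟪y_e, E y_e⟫² ≥ (1/4)·min(a⁴, a²h², h⁴)·‖E‖²_F`
(`‖E‖²_F = Σ eᵢᵢ² + 2Σ_{i<j} eᵢⱼ²`).  Blocks: `(e₀₀ + e₁₁, e₂₂)`, `(e₀₀ − e₁₁, e₁₂)`, `(e₀₁, e₀₂)`; the odd terms are absorbed by the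
`2 × 2` determinants. [folklore] -/
theorem hcpTet_strain_form_ge (a h e₀₀ e₁₁ e₂₂ e₀₁ e₀₂ e₁₂ : ℝ) :
    1 / 4 * min (min (a ^ 4) (a ^ 2 * h ^ 2)) (h ^ 4) *
        (e₀₀ ^ 2 + e₁₁ ^ 2 + e₂₂ ^ 2 + 2 * e₀₁ ^ 2 + 2 * e₀₂ ^ 2 + 2 * e₁₂ ^ 2) ≤
      ∑ s ∈ hcpTetIdx,
        (e₀₀ * hcpSite a h s 0 ^ 2 + e₁₁ * hcpSite a h s 1 ^ 2 + e₂₂ * hcpSite a h s 2 ^ 2 +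
            2 * e₀₁ * (hcpSite a h s 0 * hcpSite a h s 1) + 2 * e₀₂ * (hcpSite a h s 0 * hcpSite a h s 2) +
          2 * e₁₂ * (hcpSite a h s 1 * hcpSite a h s 2)) ^ 2 := by
  rw [hcpTet_strain_form]
  set μ := min (min (a ^ 4) (a ^ 2 * h ^ 2)) (h ^ 4) with hμ
  have hμ1 : μ ≤ a ^ 4 := (min_le_left _ _).trans (min_le_left _ _)
  have hμ2 : μ ≤ a ^ 2 * h ^ 2 := (min_le_left _ _).trans (min_le_right _ _)
  have hμ3 : μ ≤ h ^ 4 := min_le_right _ _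
  have h3 : (√3 : ℝ) ^ 2 = 3 := Real.sq_sqrt (by norm_num)
  -- the two squares that absorb the odd terms, expanded with `√3² = 3`
  have sq1 : 0 ≤ 1 / 3 * a ^ 4 * e₀₁ ^ 2 + 2 * √3 / 3 * a ^ 3 * h * (e₀₁ * e₀₂) + a ^ 2 * h ^ 2 * e₀₂ ^ 2 := by
    have e : (√3 / 3 * a ^ 2 * e₀₁ + a * h * e₀₂) ^ 2 =
        1 / 3 * a ^ 4 * e₀₁ ^ 2 + 2 * √3 / 3 * a ^ 3 * h * (e₀₁ * e₀₂) + a ^ 2 * h ^ 2 * e₀₂ ^ 2 := by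
      ring_nf; rw [h3]; ring
    rw [← e]; exact sq_nonneg _
  have sq2 : 0 ≤ 1 / 12 * a ^ 4 * (e₀₀ - e₁₁) ^ 2 + √3 / 3 * a ^ 3 * h * ((e₀₀ - e₁₁) * e₁₂) + a ^ 2 * h ^ 2 * e₁₂ ^ 2 := by
    have e : (√3 / 6 * a ^ 2 * (e₀₀ - e₁₁) + a * h * e₁₂) ^ 2 =
        1 / 12 * a ^ 4 * (e₀₀ - e₁₁) ^ 2 + √3 / 3 * a ^ 3 * h * ((e₀₀ - e₁₁) * e₁₂) + a ^ 2 * h ^ 2 * e₁₂ ^ 2 := by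
      ring_nf; rw [h3]; ring
    rw [← e]; exact sq_nonneg _
  -- block (e₀₁, e₀₂):  5/3 a⁴ e₀₁² + 2a²h² e₀₂² + (2√3/3) a³h e₀₁e₀₂ − μ/2 (e₀₁² + e₀₂²) ≥ 0
  have b1 : 0 ≤ (5 / 3 * a ^ 4 - 1 / 2 * μ) * e₀₁ ^ 2 + (2 * a ^ 2 * h ^ 2 - 1 / 2 * μ) * e₀₂ ^ 2 +
      2 * √3 / 3 * a ^ 3 * h * (e₀₁ * e₀₂) := by
    nlinarith [sq1, mul_nonneg (sub_nonneg.2 hμ1) (sq_nonneg e₀₁), mul_nonneg (sub_nonneg.2 hμ2) (sq_nonneg e₀₂),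
      sq_nonneg (a ^ 2 * e₀₁), sq_nonneg (a * h * e₀₂)]
  -- block (m = e₀₀ − e₁₁, e₁₂):  5/12 a⁴ m² + 2a²h² e₁₂² + (√3/3) a³h m e₁₂ − μ (m²/8 + e₁₂²/2) ≥ 0
  have b2 : 0 ≤ (5 / 12 * a ^ 4 - 1 / 8 * μ) * (e₀₀ - e₁₁) ^ 2 + (2 * a ^ 2 * h ^ 2 - 1 / 2 * μ) * e₁₂ ^ 2 +
      √3 / 3 * a ^ 3 * h * ((e₀₀ - e₁₁) * e₁₂) := by
    nlinarith [sq2, mul_nonneg (sub_nonneg.2 hμ1) (sq_nonneg (e₀₀ - e₁₁)), mul_nonneg (sub_nonneg.2 hμ2) (sq_nonneg e₁₂),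
      sq_nonneg (a ^ 2 * (e₀₀ - e₁₁)), sq_nonneg (a * h * e₁₂)]
  -- block (p = e₀₀ + e₁₁, e₂₂):  5/6 a⁴ p² + a²h² p e₂₂ + 3h⁴ e₂₂² − μ (p²/8 + e₂₂²/4) ≥ 0
  have b3 : 0 ≤ (5 / 6 * a ^ 4 - 1 / 8 * μ) * (e₀₀ + e₁₁) ^ 2 + (3 * h ^ 4 - 1 / 4 * μ) * e₂₂ ^ 2 +
      a ^ 2 * h ^ 2 * ((e₀₀ + e₁₁) * e₂₂) := by
    nlinarith [sq_nonneg (1 / 2 * a ^ 2 * (e₀₀ + e₁₁) + h ^ 2 * e₂₂), mul_nonneg (sub_nonneg.2 hμ1) (sq_nonneg (e₀₀ + e₁₁)),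
      mul_nonneg (sub_nonneg.2 hμ3) (sq_nonneg e₂₂), sq_nonneg (a ^ 2 * (e₀₀ + e₁₁)), sq_nonneg (h ^ 2 * e₂₂)]
  nlinarith [b1, b2, b3]

/-- The tetrahedron form is nonnegative. -/
theorem fpTet_nonneg (a h : ℝ) (G : Fin 3 → Fin 3 → ℝ) : 0 ≤ fpTet a h G :=
  Finset.sum_nonneg fun _ _ => sq_nonneg _

/-- **The tetrahedron form is dominated by the shell form** (a subset of the same nonnegative terms). -/
theorem fpTet_le_fpShell (a h : ℝ) (G : Fin 3 → Fin 3 → ℝ) : fpTet a h G ≤ fpShell a h G :=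
  Finset.sum_le_sum_of_subset_of_nonneg hcpTetIdx_subset_star fun _ _ _ => sq_nonneg _

/-- **Element receipts bound**: `min(a⁴, a²h², h⁴)·fpRec G ≤ 16·fpTet a h G` for ALL `a, h` — the isotropic receipts density of the affine interpolant
on the tetrahedron is paid by the stretches of its six (lattice-bond) edges, with a crude constant (`(tr G)² ≤ 3Σ(sym G)ᵢᵢ²` and
`hcpTet_strain_form_ge`). -/
theorem fpRec_le_tet (a h : ℝ) (G : Fin 3 → Fin 3 → ℝ) :
    min (min (a ^ 4) (a ^ 2 * h ^ 2)) (h ^ 4) * fpRec G ≤ 16 * fpTet a h G := by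
  set μ := min (min (a ^ 4) (a ^ 2 * h ^ 2)) (h ^ 4) with hμ
  have h1 := hcpTet_strain_form_ge a h (G 0 0) (G 1 1) (G 2 2) ((G 0 1 + G 1 0) / 2) ((G 0 2 + G 2 0) / 2)
    ((G 1 2 + G 2 1) / 2)
  rw [← hμ] at h1
  have hT : fpTet a h G = ∑ s ∈ hcpTetIdx,
      (G 0 0 * hcpSite a h s 0 ^ 2 + G 1 1 * hcpSite a h s 1 ^ 2 + G 2 2 * hcpSite a h s 2 ^ 2 +
          2 * ((G 0 1 + G 1 0) / 2) * (hcpSite a h s 0 * hcpSite a h s 1) +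
          2 * ((G 0 2 + G 2 0) / 2) * (hcpSite a h s 0 * hcpSite a h s 2) +
        2 * ((G 1 2 + G 2 1) / 2) * (hcpSite a h s 1 * hcpSite a h s 2)) ^ 2 := rfl
  have hμ0 : 0 ≤ μ := by positivity
  have hR : fpRec G ≤ 4 * (G 0 0 ^ 2 + G 1 1 ^ 2 + G 2 2 ^ 2 + 2 * ((G 0 1 + G 1 0) / 2) ^ 2 +
      2 * ((G 0 2 + G 2 0) / 2) ^ 2 + 2 * ((G 1 2 + G 2 1) / 2) ^ 2) := by
    unfold fpRec fpTr fpSymSq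
    nlinarith [sq_nonneg (G 0 0 - G 1 1), sq_nonneg (G 0 0 - G 2 2), sq_nonneg (G 1 1 - G 2 2),
      sq_nonneg ((G 0 1 + G 1 0) / 2), sq_nonneg ((G 0 2 + G 2 0) / 2), sq_nonneg ((G 1 2 + G 2 1) / 2)]
  rw [hT]
  nlinarith [mul_le_mul_of_nonneg_left hR hμ0, h1]

end Summit.AtomisticToContinuum.Crystallization.Theorems.StrictSplittingRuleBirth
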